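import Literature.MathematicalPhysics.QuantumManyBody.OneBodyCurrentGain
import Literature.MathematicalPhysics.QuantumManyBody.LangevinGenerator
import Literature.MathematicalPhysics.QuantumManyBody.PeriodicBoseGasImpurityTranslation
import Mathlib.Analysis.SpecialFunctions.Trigonometric.Deriv
import Mathlib.Analysis.InnerProductSpace.Calculus
import Mathlib.Algebra.QuadraticDiscriminant
import HarnessLib

/-!
# Kinematic bound on the phased density wave of a periodic Bose trial state

Route `BECThomsonPrinciple`, crux `GaussianDominationCan` (stmt-AtomisticToContinuum-9479), line
`ward-chord-splitting`: the registered helper stub `densityWave_sq_le_kinetic` toward stub S2 (`WeakDensityChord`),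
landed as a stand-alone, definition-free theorem.

**Statement** (`densityWave_sq_le_kinetic`). For every particle number `N`, side `L`, lattice mode `n : ℤ³` with
`n ≠ 0`, phase `θ` and every periodic Bose trial state `Φ`, with `k = (2π/L) n`, `|k|² = (2π/L)² ∑ⱼ nⱼ²`:

  `|D_θ(Φ)|² ≤ 4 N T(Φ) / |k|²`,

where `D_θ(Φ) = ∫_{[0,L)^{3N}} (∑ᵢ cos(k·xᵢ + θ)) |Φ(X)|² dX` is the phased density wave and
`T(Φ) = cellKineticEnergy L Φ.ψ = ∫_{[0,L)^{3N}} ∑ᵢ ∑ₗ |∂_{i,l}Φ|²` the kinetic energy. It holds for every state and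
every interaction (it is purely kinematic) and is the `v`-independent half of the density chord of the line.

**Proof.** `cos(k·x + θ) = -|k|⁻² div_x(k sin(k·x + θ))`, so by integration by parts on the torus in particle `i`
(`integral_cellN_pderiv_eq_zero` of `LangevinGenerator.lean`, applied to the `C¹` lattice-periodic flux
`sin(k·xᵢ + θ)|Φ|²`; no boundary terms), `|k|² ∫ cos(k·xᵢ + θ)|Φ|² = -∫ sin(k·xᵢ + θ) (k·∇ᵢ)|Φ|²` with
`(k·∇ᵢ)|Φ|² = 2 Re(conj Φ · ∑ₗ kₗ ∂_{i,l}Φ)` (`pderiv_densityFlux`, `densityWave_ibp_axis`).  Pointwise,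
`|2 sin · Re(conj Φ · ∑ₗ kₗ ∂_{i,l}Φ)| ≤ 2|Φ| |k| (∑ₗ|∂_{i,l}Φ|²)^{1/2}`, which we use in the square-free form
`-t(…) ≤ t²|Φ|² + |k|² ∑ₗ |∂_{i,l}Φ|²` for every real `t` (`neg_mul_sum_flux_le`); integrating, using `∫|Φ|² = 1`
and summing over `i` gives the chord `t |k|² D ≤ N t² + |k|² T` for all `t` (`densityWave_particle_chord`), whose
discriminant is the claim.  The linear phase is handled as an arbitrary `κ : ℝ³ →L[ℝ] ℝ` with `κ(L eₗ) ∈ 2πℤ`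
(`densityWave_sq_le_kinetic_clm`), then specialised to `κ = (2π/L) ∑ⱼ nⱼ πⱼ`.  For `N = 0` both sides vanish; for
`N ≥ 1` a trial state forces `0 < L` (`PeriodicTrialState.side_pos`).

References: the density–current (f-sum) kinematics behind the Bogoliubov/Onsager bounds, e.g. Pines–Nozières,
*The Theory of Quantum Liquids* I §2.4; Lieb–Seiringer–Solovej–Yngvason, *The Mathematics of the Bose Gas and its
Condensation* (2005) §5.2.  All statements below are [folklore]-level calculus.
-/

noncomputable section

namespace Summit.AtomisticToContinuum.BoseEinsteinCondensation.Cruxes.GaussianDominationCan.WardChordSplitting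

open MeasureTheory
open scoped ENNReal ComplexConjugate
open Literature.MathematicalPhysics.QuantumManyBody.BoseGas

variable {N : ℕ} {L : ℝ}

section Pointwise

variable (κ : Space →L[ℝ] ℝ) (θ : ℝ)

/-- The density-wave flux `X ↦ sin(κ xᵢ + θ) ‖Φ(X)‖²` is `C¹` for `Φ ∈ C¹`. [folklore] -/
theorem contDiff_densityFlux {ψ : Config N → ℂ} (hψ : ContDiff ℝ 1 ψ) (i : Fin N) :
    ContDiff ℝ 1 fun X : Config N => Real.sin (κ (X i) + θ) * ‖ψ X‖ ^ 2 :=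
  (Real.contDiff_sin.comp (((κ.contDiff).comp (contDiff_apply ℝ Space i)).add contDiff_const)).mul
    (hψ.norm_sq ℂ)

/-- Product and chain rule for the flux:
`∂_{i,l}(sin(κ xᵢ + θ)‖Φ‖²) = cos(κ xᵢ + θ) κ(eₗ) ‖Φ‖² + sin(κ xᵢ + θ) · 2 Re(conj Φ · ∂_{i,l}Φ)`. [folklore] -/
theorem pderiv_densityFlux {ψ : Config N → ℂ} (hψ : Differentiable ℝ ψ) (i : Fin N) (l : Fin 3)
    (X : Config N) :
    pderiv i l (fun Y : Config N => Real.sin (κ (Y i) + θ) * ‖ψ Y‖ ^ 2) X =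
      Real.cos (κ (X i) + θ) * κ (EuclideanSpace.single l 1) * ‖ψ X‖ ^ 2 +
        Real.sin (κ (X i) + θ) *
          (2 * ((starRingEnd ℂ) (ψ X) * fderiv ℝ ψ X (Pi.single i (EuclideanSpace.single l 1))).re) := by
  have hp : HasFDerivAt (fun Y : Config N => κ (Y i) + θ)
      (κ.comp (ContinuousLinearMap.proj (R := ℝ) (φ := fun _ : Fin N => Space) i)) X :=
    ((κ.comp (ContinuousLinearMap.proj (R := ℝ) (φ := fun _ : Fin N => Space) i)).hasFDerivAt).add_const θ
  have h1 : HasFDerivAt (fun Y : Config N => Real.sin (κ (Y i) + θ))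
      (Real.cos (κ (X i) + θ) • κ.comp (ContinuousLinearMap.proj (R := ℝ) (φ := fun _ : Fin N => Space) i)) X :=
    (Real.hasDerivAt_sin _).comp_hasFDerivAt X hp
  have h2 : HasFDerivAt (fun Y : Config N => ‖ψ Y‖ ^ 2)
      (2 • (innerSL ℝ (ψ X)).comp (fderiv ℝ ψ X)) X := (hψ X).hasFDerivAt.norm_sq
  have h12 : HasFDerivAt (fun Y : Config N => Real.sin (κ (Y i) + θ) * ‖ψ Y‖ ^ 2)
      (Real.sin (κ (X i) + θ) • (2 • (innerSL ℝ (ψ X)).comp (fderiv ℝ ψ X)) +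
        ‖ψ X‖ ^ 2 • (Real.cos (κ (X i) + θ) •
          κ.comp (ContinuousLinearMap.proj (R := ℝ) (φ := fun _ : Fin N => Space) i))) X :=
    h1.mul h2
  rw [pderiv, h12.fderiv]
  simp only [add_apply, FunLike.coe_smul, Pi.smul_apply, ContinuousLinearMap.coe_comp, Function.comp_apply,
    ContinuousLinearMap.proj_apply, Pi.single_eq_same, innerSL_apply_apply, Complex.inner]
  simp only [smul_eq_mul, nsmul_eq_mul, Nat.cast_ofNat]
  ring

end Pointwise

/-! ### Periodicity and torus integration by parts against the density wave -/

/-- The flux `sin(κ xᵢ + θ)‖Φ‖²` is lattice periodic when `κ(L eₘ) ∈ 2πℤ` for every axis and `Φ` is a periodic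
trial state. [folklore] -/
theorem isLatticePeriodic_densityFlux {κ : Space →L[ℝ] ℝ}
    (hper : ∀ l : Fin 3, ∃ m : ℤ, κ (EuclideanSpace.single l L) = 2 * Real.pi * m) (θ : ℝ)
    (Φ : PeriodicTrialState N L) (i : Fin N) :
    IsLatticePeriodic L fun X : Config N => Real.sin (κ (X i) + θ) * ‖Φ.ψ X‖ ^ 2 := by
  intro X j m
  simp only [Φ.periodic X j m, Pi.add_apply]
  congr 1
  by_cases hji : j = i
  · subst hji
    obtain ⟨z, hz⟩ := hper m
    rw [Pi.single_eq_same, map_add, hz,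
      show κ (X j) + 2 * Real.pi * (z : ℝ) + θ = κ (X j) + θ + (z : ℤ) * (2 * Real.pi) by ring,
      Real.sin_add_int_mul_two_pi]
  · rw [Pi.single_eq_of_ne (Ne.symm hji), add_zero]

/-- `X ↦ Re(conj Φ(X) · dΦ(X) v)` is continuous for `Φ ∈ C¹`. [folklore] -/
theorem continuous_re_conj_mul_fderiv {ψ : Config N → ℂ} (hψ : ContDiff ℝ 1 ψ) (v : Config N) :
    Continuous fun X : Config N => ((starRingEnd ℂ) (ψ X) * fderiv ℝ ψ X v).re :=
  Complex.continuous_re.comp ((Complex.continuous_conj.comp hψ.continuous).mul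
    ((hψ.continuous_fderiv one_ne_zero).clm_apply continuous_const))

/-- `X ↦ g(κ xᵢ + θ)` is continuous for continuous `g` (used with `g = sin, cos`). [folklore] -/
theorem continuous_comp_phase {g : ℝ → ℝ} (hg : Continuous g) (κ : Space →L[ℝ] ℝ) (θ : ℝ) (i : Fin N) :
    Continuous fun X : Config N => g (κ (X i) + θ) :=
  hg.comp ((κ.continuous.comp (continuous_apply i)).add continuous_const)

/-- **Torus integration by parts against the density wave, one axis.** For a periodic trial state `Φ`, a linear phase
`κ` with `κ(L eₘ) ∈ 2πℤ`, a particle `i` and an axis `l`: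
`κ(eₗ) ∫_{cell^N} cos(κ xᵢ + θ)‖Φ‖² = -∫_{cell^N} sin(κ xᵢ + θ) · 2 Re(conj Φ ∂_{i,l}Φ)`
(the cell integral of `∂_{i,l}(sin(κ xᵢ + θ)‖Φ‖²)` vanishes, `integral_cellN_pderiv_eq_zero`). [folklore] -/
theorem densityWave_ibp_axis {κ : Space →L[ℝ] ℝ}
    (hper : ∀ l : Fin 3, ∃ m : ℤ, κ (EuclideanSpace.single l L) = 2 * Real.pi * m) (hL : 0 < L) (θ : ℝ)
    (Φ : PeriodicTrialState N L) (i : Fin N) (l : Fin 3) :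
    κ (EuclideanSpace.single l 1) * ∫ X in cellN N L, Real.cos (κ (X i) + θ) * ‖Φ.ψ X‖ ^ 2 =
      -∫ X in cellN N L, Real.sin (κ (X i) + θ) *
        (2 * ((starRingEnd ℂ) (Φ.ψ X) * fderiv ℝ Φ.ψ X (Pi.single i (EuclideanSpace.single l 1))).re) := by
  have h0 := integral_cellN_pderiv_eq_zero hL (G := fun Y : Config N => Real.sin (κ (Y i) + θ) * ‖Φ.ψ Y‖ ^ 2)
    (contDiff_densityFlux κ θ Φ.contDiff i) (isLatticePeriodic_densityFlux hper θ Φ i) i l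
  simp_rw [pderiv_densityFlux κ θ (Φ.contDiff.differentiable one_ne_zero) i l] at h0
  have hn2 : Continuous fun X : Config N => ‖Φ.ψ X‖ ^ 2 := (Φ.contDiff.continuous.norm).pow 2
  have hA : Integrable (fun X : Config N => Real.cos (κ (X i) + θ) * κ (EuclideanSpace.single l 1) * ‖Φ.ψ X‖ ^ 2)
      (volume.restrict (cellN N L)) :=
    integrableOn_cellN (((continuous_comp_phase Real.continuous_cos κ θ i).mul continuous_const).mul hn2) L
  have hB : Integrable (fun X : Config N => Real.sin (κ (X i) + θ) *
      (2 * ((starRingEnd ℂ) (Φ.ψ X) * fderiv ℝ Φ.ψ X (Pi.single i (EuclideanSpace.single l 1))).re))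
      (volume.restrict (cellN N L)) :=
    integrableOn_cellN ((continuous_comp_phase Real.continuous_sin κ θ i).mul
      (continuous_const.mul (continuous_re_conj_mul_fderiv Φ.contDiff _))) L
  rw [integral_add hA hB] at h0
  have hA' : ∫ X in cellN N L, Real.cos (κ (X i) + θ) * κ (EuclideanSpace.single l 1) * ‖Φ.ψ X‖ ^ 2 =
      κ (EuclideanSpace.single l 1) * ∫ X in cellN N L, Real.cos (κ (X i) + θ) * ‖Φ.ψ X‖ ^ 2 := by
    rw [← integral_const_mul]
    exact integral_congr_ae (Filter.Eventually.of_forall fun X => by ring)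
  linarith

/-! ### The pointwise kinematic bound -/

/-- Pointwise kinematic bound (finite Cauchy–Schwarz and `2ab ≤ a² + b²`): for `φ, z₁, z₂, z₃ ∈ ℂ`, `k ∈ ℝ³`, `|s| ≤ 1`
and every real `t`, `-(t ∑ₗ kₗ (s · 2Re(conj φ · zₗ))) ≤ t²‖φ‖² + (∑ₗ kₗ²)(∑ₗ ‖zₗ‖²)`. [folklore] -/
theorem neg_mul_sum_flux_le (φ : ℂ) (z : Fin 3 → ℂ) (k : Fin 3 → ℝ) {s : ℝ} (hs : |s| ≤ 1) (t : ℝ) :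
    -(t * ∑ l, k l * (s * (2 * ((starRingEnd ℂ) φ * z l).re))) ≤
      t ^ 2 * ‖φ‖ ^ 2 + (∑ l, k l ^ 2) * ∑ l, ‖z l‖ ^ 2 := by
  set w : ℂ := ∑ l, (k l : ℂ) * z l with hw
  have hsum : ∑ l, k l * (s * (2 * ((starRingEnd ℂ) φ * z l).re)) = 2 * s * ((starRingEnd ℂ) φ * w).re := by
    rw [hw, Finset.mul_sum, Complex.re_sum, Finset.mul_sum]
    refine Finset.sum_congr rfl fun l _ => ?_
    rw [show (starRingEnd ℂ) φ * ((k l : ℂ) * z l) = (k l : ℂ) * ((starRingEnd ℂ) φ * z l) by ring,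
      Complex.re_ofReal_mul]
    ring
  have hre : |((starRingEnd ℂ) φ * w).re| ≤ ‖φ‖ * ‖w‖ := by
    refine (Complex.abs_re_le_norm _).trans ?_
    rw [norm_mul, Complex.norm_conj]
  have hw1 : ‖w‖ ≤ ∑ l, |k l| * ‖z l‖ := by
    refine (norm_sum_le _ _).trans (le_of_eq (Finset.sum_congr rfl fun l _ => ?_))
    rw [norm_mul, Complex.norm_real, Real.norm_eq_abs]
  have hw2 : ‖w‖ ^ 2 ≤ (∑ l, k l ^ 2) * ∑ l, ‖z l‖ ^ 2 := by
    calc ‖w‖ ^ 2 ≤ (∑ l, |k l| * ‖z l‖) ^ 2 := pow_le_pow_left₀ (norm_nonneg _) hw1 2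
      _ ≤ (∑ l, |k l| ^ 2) * ∑ l, ‖z l‖ ^ 2 := Finset.sum_mul_sq_le_sq_mul_sq _ _ _
      _ = (∑ l, k l ^ 2) * ∑ l, ‖z l‖ ^ 2 := by simp only [sq_abs]
  rw [hsum]
  have h1 : -(t * (2 * s * ((starRingEnd ℂ) φ * w).re)) ≤ 2 * |t| * (‖φ‖ * ‖w‖) :=
    calc -(t * (2 * s * ((starRingEnd ℂ) φ * w).re))
        ≤ |t * (2 * s * ((starRingEnd ℂ) φ * w).re)| := neg_le_abs _
      _ = 2 * |t| * (|s| * |((starRingEnd ℂ) φ * w).re|) := by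
          rw [abs_mul, abs_mul, abs_mul, abs_two]; ring
      _ ≤ 2 * |t| * (1 * (‖φ‖ * ‖w‖)) :=
          mul_le_mul_of_nonneg_left (mul_le_mul hs hre (abs_nonneg _) zero_le_one) (by positivity)
      _ = 2 * |t| * (‖φ‖ * ‖w‖) := by ring
  have h2 : 2 * |t| * (‖φ‖ * ‖w‖) ≤ t ^ 2 * ‖φ‖ ^ 2 + ‖w‖ ^ 2 := by
    nlinarith [sq_nonneg (|t| * ‖φ‖ - ‖w‖), sq_abs t]
  linarith

/-! ### The kinematic bound for a linear phase -/

/-- `∫_{cell^N} c ‖Φ‖² = c` for a (normalised) periodic trial state, real Bochner form. [folklore] -/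
theorem integral_const_mul_norm_sq (c : ℝ) (Φ : PeriodicTrialState N L) :
    ∫ X in cellN N L, c * ‖Φ.ψ X‖ ^ 2 = c := by
  have hint : Integrable (fun X => ‖Φ.ψ X‖ ^ 2) (volume.restrict (cellN N L)) :=
    integrableOn_cellN ((Φ.contDiff.continuous.norm).pow 2) L
  have h := ofReal_integral_eq_lintegral_ofReal hint (Filter.Eventually.of_forall fun X => sq_nonneg _)
  simp_rw [← coe_nnnorm_sq_eq_ofReal] at h
  rw [Φ.norm_eq] at h
  have hnn : 0 ≤ ∫ X in cellN N L, ‖Φ.ψ X‖ ^ 2 := integral_nonneg fun X => sq_nonneg _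
  have h1 : ∫ X in cellN N L, ‖Φ.ψ X‖ ^ 2 = 1 := by
    have := congrArg ENNReal.toReal h
    rwa [ENNReal.toReal_ofReal hnn, ENNReal.toReal_one] at this
  rw [integral_const_mul, h1, mul_one]

/-- **Per-particle chord.** With `K = ∑ₗ kₗ²`, `Dᵢ = ∫ cos(κ xᵢ + θ)‖Φ‖²`, `Tᵢ = ∫ ∑ₗ ‖∂_{i,l}Φ‖²`: for every real `t`,
`t K Dᵢ ≤ t² + K Tᵢ` (torus integration by parts in particle `i`, then the pointwise kinematic bound integrated,
using `∫‖Φ‖² = 1`). [folklore] -/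
theorem densityWave_particle_chord {κ : Space →L[ℝ] ℝ} {k : Space}
    (hk : ∀ l : Fin 3, κ (EuclideanSpace.single l (1 : ℝ)) = k l)
    (hper : ∀ l : Fin 3, ∃ m : ℤ, κ (EuclideanSpace.single l L) = 2 * Real.pi * m) (hL : 0 < L) (θ : ℝ)
    (Φ : PeriodicTrialState N L) (i : Fin N) (t : ℝ) :
    t * ((∑ l : Fin 3, k l ^ 2) * ∫ X in cellN N L, Real.cos (κ (X i) + θ) * ‖Φ.ψ X‖ ^ 2) ≤
      t ^ 2 + (∑ l : Fin 3, k l ^ 2) *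
        ∫ X in cellN N L, ∑ l : Fin 3, ‖fderiv ℝ Φ.ψ X (Pi.single i (EuclideanSpace.single l 1))‖ ^ 2 := by
  -- integrability of everything in sight
  have hF : ∀ l : Fin 3, Integrable (fun X : Config N => Real.sin (κ (X i) + θ) *
      (2 * ((starRingEnd ℂ) (Φ.ψ X) * fderiv ℝ Φ.ψ X (Pi.single i (EuclideanSpace.single l 1))).re))
      (volume.restrict (cellN N L)) := fun l =>
    integrableOn_cellN ((continuous_comp_phase Real.continuous_sin κ θ i).mul
      (continuous_const.mul (continuous_re_conj_mul_fderiv Φ.contDiff _))) L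
  have hT : Integrable (fun X : Config N => ∑ l : Fin 3,
      ‖fderiv ℝ Φ.ψ X (Pi.single i (EuclideanSpace.single l 1))‖ ^ 2) (volume.restrict (cellN N L)) :=
    integrableOn_cellN (continuous_finsetSum _ fun l _ =>
      (((Φ.contDiff.continuous_fderiv one_ne_zero).clm_apply continuous_const).norm).pow 2) L
  have hn2 : Integrable (fun X : Config N => t ^ 2 * ‖Φ.ψ X‖ ^ 2) (volume.restrict (cellN N L)) :=
    integrableOn_cellN (continuous_const.mul ((Φ.contDiff.continuous.norm).pow 2)) L
  -- `K Dᵢ = -∫ ∑ₗ kₗ sin · 2Re(conj Φ ∂_{i,l}Φ)` by integration by parts in every axis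
  have hKD : (∑ l : Fin 3, k l ^ 2) * ∫ X in cellN N L, Real.cos (κ (X i) + θ) * ‖Φ.ψ X‖ ^ 2 =
      -∫ X in cellN N L, ∑ l : Fin 3, k l * (Real.sin (κ (X i) + θ) *
        (2 * ((starRingEnd ℂ) (Φ.ψ X) * fderiv ℝ Φ.ψ X (Pi.single i (EuclideanSpace.single l 1))).re)) := by
    rw [integral_finsetSum _ fun l _ => (hF l).const_mul (k l), Finset.sum_mul, ← Finset.sum_neg_distrib]
    refine Finset.sum_congr rfl fun l _ => ?_
    rw [integral_const_mul, sq, mul_assoc, ← hk l, densityWave_ibp_axis hper hL θ Φ i l, mul_neg]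
  -- the pointwise bound, integrated
  have hpt := fun X : Config N => neg_mul_sum_flux_le (Φ.ψ X)
    (fun l => fderiv ℝ Φ.ψ X (Pi.single i (EuclideanSpace.single l 1))) (fun l => k l)
    (Real.abs_sin_le_one (κ (X i) + θ)) t
  have hsumF : Integrable (fun X : Config N => ∑ l : Fin 3, k l * (Real.sin (κ (X i) + θ) *
      (2 * ((starRingEnd ℂ) (Φ.ψ X) * fderiv ℝ Φ.ψ X (Pi.single i (EuclideanSpace.single l 1))).re)))
      (volume.restrict (cellN N L)) := integrable_finsetSum _ fun l _ => (hF l).const_mul (k l)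
  have hnegF : Integrable (fun X : Config N => -(t * ∑ l : Fin 3, k l * (Real.sin (κ (X i) + θ) *
      (2 * ((starRingEnd ℂ) (Φ.ψ X) * fderiv ℝ Φ.ψ X (Pi.single i (EuclideanSpace.single l 1))).re))))
      (volume.restrict (cellN N L)) := (hsumF.const_mul t).neg
  have hG : Integrable (fun X : Config N => t ^ 2 * ‖Φ.ψ X‖ ^ 2 + (∑ l : Fin 3, k l ^ 2) *
      ∑ l : Fin 3, ‖fderiv ℝ Φ.ψ X (Pi.single i (EuclideanSpace.single l 1))‖ ^ 2)
      (volume.restrict (cellN N L)) := hn2.add (hT.const_mul _)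
  have hmono := integral_mono hnegF hG hpt
  rw [integral_neg, integral_const_mul, integral_add hn2 (hT.const_mul _), integral_const_mul_norm_sq,
    integral_const_mul] at hmono
  rw [hKD, mul_neg]
  exact hmono

/-- **Kinematic bound on the density wave for a linear phase.** Let `κ : ℝ³ →L[ℝ] ℝ` with `κ(eₗ) = kₗ`,
`κ(L eₗ) ∈ 2πℤ`, `K = ∑ₗ kₗ² > 0`, and let `Φ` be a periodic trial state of `N` bosons on a torus of side `L > 0`. Then
`(∫_{cell^N} (∑ᵢ cos(κ xᵢ + θ)) ‖Φ‖²)² ≤ 4 N T(Φ) / K`, `T = cellKineticEnergy`. [folklore] -/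
theorem densityWave_sq_le_kinetic_clm {κ : Space →L[ℝ] ℝ} {k : Space}
    (hk : ∀ l : Fin 3, κ (EuclideanSpace.single l (1 : ℝ)) = k l)
    (hper : ∀ l : Fin 3, ∃ m : ℤ, κ (EuclideanSpace.single l L) = 2 * Real.pi * m) (hL : 0 < L)
    (hK : 0 < ∑ l : Fin 3, k l ^ 2) (θ : ℝ) (Φ : PeriodicTrialState N L) :
    |∫ X in cellN N L, (∑ i : Fin N, Real.cos (κ (X i) + θ)) * ‖Φ.ψ X‖ ^ 2| ^ 2 ≤
      4 * N * cellKineticEnergy L Φ.ψ / ∑ l : Fin 3, k l ^ 2 := by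
  set K : ℝ := ∑ l : Fin 3, k l ^ 2 with hKdef
  set D : ℝ := ∫ X in cellN N L, (∑ i : Fin N, Real.cos (κ (X i) + θ)) * ‖Φ.ψ X‖ ^ 2 with hD
  set T : ℝ := cellKineticEnergy L Φ.ψ with hTdef
  -- `D = ∑ᵢ Dᵢ`, `T = ∑ᵢ Tᵢ`
  have hn2 : Continuous fun X : Config N => ‖Φ.ψ X‖ ^ 2 := (Φ.contDiff.continuous.norm).pow 2
  have hDi : D = ∑ i : Fin N, ∫ X in cellN N L, Real.cos (κ (X i) + θ) * ‖Φ.ψ X‖ ^ 2 := by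
    rw [hD, ← integral_finsetSum]
    · exact integral_congr_ae (Filter.Eventually.of_forall fun X => Finset.sum_mul _ _ _)
    · intro i _
      exact integrableOn_cellN ((continuous_comp_phase Real.continuous_cos κ θ i).mul hn2) L
  have hTi : T = ∑ i : Fin N, ∫ X in cellN N L, ∑ l : Fin 3,
      ‖fderiv ℝ Φ.ψ X (Pi.single i (EuclideanSpace.single l 1))‖ ^ 2 := by
    rw [hTdef, cellKineticEnergy, ← integral_finsetSum]
    · rfl
    · intro i _
      exact integrableOn_cellN (continuous_finsetSum _ fun l _ =>
        (((Φ.contDiff.continuous_fderiv one_ne_zero).clm_apply continuous_const).norm).pow 2) L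
  -- the chord `t K D ≤ N t² + K T` for every real `t`
  have hchord : ∀ t : ℝ, t * (K * D) ≤ N * t ^ 2 + K * T := by
    intro t
    have h := Finset.sum_le_sum fun i (_ : i ∈ Finset.univ) => densityWave_particle_chord hk hper hL θ Φ i t
    rw [Finset.sum_add_distrib, Finset.sum_const, Finset.card_univ, Fintype.card_fin, nsmul_eq_mul,
      ← Finset.mul_sum, ← Finset.mul_sum, ← Finset.mul_sum, ← hTi, ← hDi] at h
    exact h
  -- discriminant
  have hdisc : discrim (N : ℝ) (-(K * D)) (K * T) ≤ 0 := by
    refine discrim_le_zero fun t => ?_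
    have := hchord t
    nlinarith [this]
  rw [discrim] at hdisc
  rw [sq_abs, le_div_iff₀ hK]
  refine le_of_mul_le_mul_left ?_ hK
  nlinarith [hdisc]

/-- **Kinematic bound on the phased density wave** (helper stub `densityWave_sq_le_kinetic` of line
`ward-chord-splitting`, definition-free). For every `N`, `L`, lattice mode `n ≠ 0`, phase `θ` and every periodic Bose
trial state `Φ`, with `k = (2π/L) n`, `|k|² = (2π/L)² ∑ⱼ nⱼ²` and `T(Φ) = ∫_{cell^N} ∑ᵢ∑ₗ |∂_{i,l}Φ|²`:
`|∫_{cell^N} (∑ᵢ cos(k·xᵢ + θ)) |Φ|² dX|² ≤ 4 N T(Φ) / |k|²`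
(integration by parts on the torus: `cos(k·x+θ) = -div(k sin(k·x+θ))/|k|²`, then Cauchy–Schwarz twice and
`∫|Φ|² = 1`). Holds for every state and every interaction; it is the kinematic half of the density chord
`WeakDensityChord`. [folklore] -/
theorem densityWave_sq_le_kinetic : ∀ (N : ℕ) (L : ℝ) (n : Fin 3 → ℤ) (θ : ℝ) (Φ : PeriodicTrialState N L), n ≠ 0 →
    |∫ X in cellN N L, (∑ i : Fin N, Real.cos (2 * Real.pi / L * (∑ j, (n j : ℝ) * X i j) + θ)) * ‖Φ.ψ X‖ ^ 2| ^ 2 ≤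
      4 * N * cellKineticEnergy L Φ.ψ / ((2 * Real.pi / L) ^ 2 * ∑ j, (n j : ℝ) ^ 2) := by
  intro N L n θ Φ hn
  cases N with
  | zero => simp
  | succ m =>
    have hL : 0 < L := Φ.side_pos
    -- the linear phase `κ = (2π/L) ∑ⱼ nⱼ πⱼ` and the mode vector `k = (2π/L) n`
    set κ : Space →L[ℝ] ℝ := (2 * Real.pi / L) • ∑ j : Fin 3, (n j : ℝ) • PiLp.proj 2 (fun _ : Fin 3 => ℝ) j
      with hκ
    set k : Space := WithLp.toLp 2 fun j => 2 * Real.pi / L * (n j : ℝ) with hkdef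
    have hκx : ∀ x : Space, κ x = 2 * Real.pi / L * ∑ j, (n j : ℝ) * x j := fun x => by
      simp only [hκ, _root_.smul_apply, _root_.sum_apply, PiLp.proj_apply, smul_eq_mul]
    have hk : ∀ l : Fin 3, κ (EuclideanSpace.single l (1 : ℝ)) = k l := fun l => by
      rw [hκx, hkdef]
      simp [Finset.sum_ite_eq']
    have hL' : L ≠ 0 := hL.ne'
    have hper : ∀ l : Fin 3, ∃ m : ℤ, κ (EuclideanSpace.single l L) = 2 * Real.pi * m := fun l => by
      refine ⟨n l, ?_⟩
      rw [hκx]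
      simp only [PiLp.single_apply, mul_ite, mul_zero, Finset.sum_ite_eq', Finset.mem_univ, if_true]
      field_simp
    have hKk : ∑ l : Fin 3, k l ^ 2 = (2 * Real.pi / L) ^ 2 * ∑ j, (n j : ℝ) ^ 2 := by
      rw [Finset.mul_sum]
      refine Finset.sum_congr rfl fun l _ => ?_
      rw [hkdef, PiLp.toLp_apply]
      ring
    have hK : 0 < ∑ l : Fin 3, k l ^ 2 := by
      rw [hKk]
      obtain ⟨j, hj⟩ := Function.ne_iff.mp hn
      have hj' : (n j : ℝ) ≠ 0 := by exact_mod_cast hj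
      have hS : 0 < ∑ j, (n j : ℝ) ^ 2 :=
        Finset.sum_pos' (fun _ _ => sq_nonneg _) ⟨j, Finset.mem_univ _, by positivity⟩
      have hc : 0 < 2 * Real.pi / L := by positivity
      positivity
    have h := densityWave_sq_le_kinetic_clm hk hper hL hK θ Φ
    simp only [hκx, hKk] at h
    exact h

end Summit.AtomisticToContinuum.BoseEinsteinCondensation.Cruxes.GaussianDominationCan.WardChordSplitting

end
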